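import Summits.ValiantsHypothesis.ValiantsHypothesis.Theorems.MonotoneRestorationOrbitRestorationQPDepthThreeRungDefs
import Summits.ValiantsHypothesis.ValiantsHypothesis.Theorems.MonotoneRestorationOrbitRestorationQPVsbr
import Summits.ValiantsHypothesis.ValiantsHypothesis.Theorems.ChowBorderDepth3SPSNormalForm
import HarnessLib

/-!
# Route MonotoneRestoration — crux `OrbitRestorationQP` (stmt-ValiantsHypothesis-18293), line `depth-three-rung`:
# THE RUNG `A_∞` IS EQUIVALENT TO ITS EXPLICIT-REPRESENTATION FORM

The open stub `stub_sigmaPiSigmaValue` (A_∞) of `Cruxes/OrbitRestorationQP/Lines/depth_three_rung.lean` is stated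
on the product-depth slice `PDClass (fun _ => 1)` (an unbounded-fan-in `ArithCircuit` of product depth `≤ 1`
with `≤ n^c + c` wires), whereas EVERY landed partial result toward it — stub B
(`stub_circuitOfEquivariantTerms`), A₁ (`stub_piSigmaValue`), A_k (`stub_sigmaPiSigmaKValue`), the factor-multiset
criterion `ValueProducts.qpOrbitRestorable_of_affineProductTerms`, the box-volume and catalecticant strata — is
stated on EXPLICIT depth-three data `f n = Σ_i C(a i) · Π (L i)` (multisets `L i` of affine forms).  This file
closes the bookkeeping gap once and for all:

* `pdClass_mono_const` — `PDClass δ n c` is monotone in the exponent `c`;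
* `exists_explicit_of_pdClassOne` — **EXTRACTION**: a polynomial in `PDClass (fun _ => 1) n c` IS a sum of
  `≤ n^(c+2) + (c+2)` scaled products of `≤ n^(c+2) + (c+2)` affine forms (the explicit `ΣΠΣ` data of a
  product-depth-one circuit, the tree theorem `exists_sps_of_productDepth_le_one`
  (`Theorems/ChowBorderDepth3SPSNormalForm.lean`, Landsberg 2017 §7.1 / GKKS 2016 §1 eq. (1)), repackaged in the
  line's multiset currency; all scalars `a i = 1`);
* `sigmaPiSigmaValue_iff_explicit` — **A_∞ ⟺ EXPLICIT A_∞**: the registered stub (quoted verbatim) is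
  equivalent to the statement "every matrix-symmetric family given at every level `n` as
  `f n = Σ_{i<k} C(a i) · Π (L i)` with `k ≤ n^c + c`, every `L i` a multiset of `≤ n^c + c` polynomials of total
  degree `≤ 1`, AND `f n ∈ PDClass 1 n c`, is quasi-polynomially orbit-restorable" — the exact shape of the
  landed stubs A₁ / A_k with the number of terms unbounded.  A planner may therefore re-register A_∞ in explicit
  currency at no change of strength, and a prover of A_∞ may assume the representation.

Everything is proved; no stub is proved or refuted; VP ≠ VNP is not touched. [folklore]

## References
* A. Gupta, P. Kamath, N. Kayal, R. Saptharishi, *Arithmetic circuits: a chasm at depth three*, SIAM J. Comput.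
  45 (2016), §1 eq. (1). [GuptaKamathKayalSaptharishi2016]
* N. Limaye, S. Srinivasan, S. Tavenas, *Superpolynomial lower bounds against low-depth algebraic circuits*,
  J. ACM 72 (2025), §7 Lemma 19 (sum closure). [LimayeSrinivasanTavenas2025]
-/

noncomputable section

open scoped Classical

-- `Summit.ValiantsHypothesis.ValiantsHypothesis.…` is the tree's single-conjunct layout (Sub = Summit).
set_option linter.dupNamespace false

namespace Summit.ValiantsHypothesis.ValiantsHypothesis.Theorems.OrbitRestorationQPDepthThreeRung

namespace ExplicitForm

open Literature.Computability.AlgebraicComplexity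
open MvPolynomial

variable {n : ℕ}

/-! ### Bookkeeping -/

/-- `PDClass δ n c` is monotone in the exponent `c`. [folklore] -/
theorem pdClass_mono_const {δ : ℕ → ℕ} {c c' : ℕ} (h : c ≤ c') {q : MvPolynomial (Fin n × Fin n) ℂ}
    (hq : PDClass δ n c q) : PDClass δ n c' q := by
  obtain ⟨hdeg, hcx, P, hP, hpd, hE⟩ := hq
  exact ⟨hdeg.trans (vsbr_pbound_mono h n), hcx.trans (vsbr_pbound_mono h n), P, hP, hpd,
    hE.trans (vsbr_pbound_mono h n)⟩

/-! ### Extraction -/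

/-- **EXTRACTION of explicit depth-three data from the product-depth slice.**  If `q ∈ PDClass (fun _ => 1) n c`
then `q = Σ_{i<k} C(a i) · Π (L i)` with `k ≤ n^(c+2) + (c+2)` terms, each `L i` a multiset of
`≤ n^(c+2) + (c+2)` polynomials of total degree `≤ 1` (the normal form of a product-depth-one circuit with `≤ n^c + c` wires: at most wires `+ 1` terms and
factors, all scalars `1`). [cite: GuptaKamathKayalSaptharishi2016, §1 eq. (1)] -/
theorem exists_explicit_of_pdClassOne {c : ℕ} {q : MvPolynomial (Fin n × Fin n) ℂ}
    (hq : PDClass (fun _ => 1) n c q) :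
    ∃ (k : ℕ) (a : Fin k → ℂ) (L : Fin k → Multiset (MvPolynomial (Fin n × Fin n) ℂ)),
      (∀ i, ∀ ℓ ∈ L i, ℓ.totalDegree ≤ 1) ∧ k ≤ n ^ (c + 2) + (c + 2) ∧
      (∀ i, Multiset.card (L i) ≤ n ^ (c + 2) + (c + 2)) ∧
      q = ∑ i, C (a i) * (L i).prod := by
  obtain ⟨-, -, P, hP, hpd, hE⟩ := hq
  obtain ⟨ℓ, hdeg, hsum⟩ := exists_sps_of_productDepth_le_one P hpd
  -- wires `+ 1 ≤ n^(c+2) + (c+2)`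
  have hb : n ^ c + c + 1 ≤ n ^ (c + 2) + (c + 2) := by
    rcases Nat.eq_zero_or_pos n with rfl | hn
    · rcases Nat.eq_zero_or_pos c with rfl | hc
      · simp
      · rw [zero_pow (by omega), zero_pow (by omega)]; omega
    · have : n ^ c ≤ n ^ (c + 2) := Nat.pow_le_pow_right hn (by omega)
      omega
  refine ⟨P.edgeSize + 1, fun _ => 1,
    fun i => (Finset.univ : Finset (Fin (P.edgeSize + 1))).val.map (ℓ i), ?_, ?_, ?_, ?_⟩
  · intro i l hl
    obtain ⟨j, -, rfl⟩ := Multiset.mem_map.1 hl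
    exact hdeg i j
  · exact (Nat.add_le_add_right hE 1).trans hb
  · intro i
    rw [Multiset.card_map, Finset.card_val, Finset.card_univ, Fintype.card_fin]
    exact (Nat.add_le_add_right hE 1).trans hb
  · have hev : P.eval = q := hP
    rw [← hev, ← hsum]
    refine Finset.sum_congr rfl fun i _ => ?_
    rw [C_1, one_mul, ← Finset.prod_eq_multiset_prod]

/-! ### The equivalence -/

/-- **THE RUNG `A_∞` IS EQUIVALENT TO ITS EXPLICIT FORM.**  The registered stub `stub_sigmaPiSigmaValue` of line
`depth-three-rung` (left-hand side, verbatim) holds iff every matrix-symmetric family that lies in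
`PDClass (fun _ => 1) n c` AND is given at every level as `f n = Σ_{i<k} C(a i) · Π (L i)` with `k ≤ n^c + c`
and every `L i` a multiset of `≤ n^c + c` polynomials of total degree `≤ 1` is quasi-polynomially
orbit-restorable (right-hand side: the shape of the landed stubs A₁ / A_k with unboundedly many terms).
(`→`: forget the data; `←`: `exists_explicit_of_pdClassOne` at exponent `c + 2`.) [folklore] -/
theorem sigmaPiSigmaValue_iff_explicit :
    (∀ f : (n : ℕ) → MvPolynomial (Fin n × Fin n) ℂ, IsMatrixSymmetric f →
        (∃ c : ℕ, ∀ n : ℕ, PDClass (fun _ => 1) n c (f n)) →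
        ∃ c : ℕ, ∀ n : ℕ, QPOrbitRestorable c n (f n)) ↔
    (∀ f : (n : ℕ) → MvPolynomial (Fin n × Fin n) ℂ, IsMatrixSymmetric f →
        (∃ c : ℕ, ∀ n : ℕ, PDClass (fun _ => 1) n c (f n) ∧
          ∃ (k : ℕ) (a : Fin k → ℂ) (L : Fin k → Multiset (MvPolynomial (Fin n × Fin n) ℂ)),
            (∀ i, ∀ ℓ ∈ L i, ℓ.totalDegree ≤ 1) ∧ k ≤ n ^ c + c ∧
            (∀ i, Multiset.card (L i) ≤ n ^ c + c) ∧ f n = ∑ i, MvPolynomial.C (a i) * (L i).prod) →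
        ∃ c : ℕ, ∀ n : ℕ, QPOrbitRestorable c n (f n)) := by
  constructor
  · intro hA f hsym hexp
    obtain ⟨c, hc⟩ := hexp
    exact hA f hsym ⟨c, fun n => (hc n).1⟩
  · intro hE f hsym hPD
    obtain ⟨c, hc⟩ := hPD
    refine hE f hsym ⟨c + 2, fun n => ⟨pdClass_mono_const (by omega) (hc n), ?_⟩⟩
    obtain ⟨k, a, L, hdeg, hk, hcard, hfn⟩ := exists_explicit_of_pdClassOne (hc n)
    exact ⟨k, a, L, hdeg, hk, hcard, hfn⟩

/-- **Corollary (the usable direction, by name).**  To prove the registered stub `stub_sigmaPiSigmaValue` it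
suffices to prove its explicit form. [folklore] -/
theorem sigmaPiSigmaValue_of_explicit
    (hE : ∀ f : (n : ℕ) → MvPolynomial (Fin n × Fin n) ℂ, IsMatrixSymmetric f →
        (∃ c : ℕ, ∀ n : ℕ, PDClass (fun _ => 1) n c (f n) ∧
          ∃ (k : ℕ) (a : Fin k → ℂ) (L : Fin k → Multiset (MvPolynomial (Fin n × Fin n) ℂ)),
            (∀ i, ∀ ℓ ∈ L i, ℓ.totalDegree ≤ 1) ∧ k ≤ n ^ c + c ∧
            (∀ i, Multiset.card (L i) ≤ n ^ c + c) ∧ f n = ∑ i, MvPolynomial.C (a i) * (L i).prod) →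
        ∃ c : ℕ, ∀ n : ℕ, QPOrbitRestorable c n (f n)) :
    ∀ f : (n : ℕ) → MvPolynomial (Fin n × Fin n) ℂ, IsMatrixSymmetric f →
        (∃ c : ℕ, ∀ n : ℕ, PDClass (fun _ => 1) n c (f n)) →
        ∃ c : ℕ, ∀ n : ℕ, QPOrbitRestorable c n (f n) :=
  sigmaPiSigmaValue_iff_explicit.2 hE

end ExplicitForm

end Summit.ValiantsHypothesis.ValiantsHypothesis.Theorems.OrbitRestorationQPDepthThreeRung

end
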